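import Mathlib
import Summits.Ventures.HodgeRepro.Statements
import Summits.Ventures.HodgeRepro.MuTableProof

/-!
# The slot characters of a `μ`-table (seat p2, gen 7)

The docstring of the sealed statement (b) reads the slot table `δ_S` as «the difference of the archimedean exponents of
the characters attached to lines `1` and `0`» and a `μ`-table as «integer exponents of the four slots».  This file makes
the characters literal on the kernel: for an exponent table `e : InfinitePlace L → ℤ` the ARCHIMEDEAN CHARACTER of
`U(1)(L) = {x ∈ L : x̄ x = 1}` is `archChar e : x ↦ ∏_w w(x)^{e(w)}` (a monoid homomorphism into `ℂ`, with values on the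
unit circle), the character of slot `k` of a table `μ` at the datum `S` is `slotChar μ S k := archChar (μ S k)`, and the
four clauses of `MuTable` become identities of characters:

* slot `0` is untouched by the sharpening, slot `k ∈ {1, 2, 3}` of `μ♯♯` is `slotChar μ S 0 · archChar δ_k`
  (`δ_1 = δ_S`, `δ_2 = δ₂`, `δ_3 = δ₃`) — the sealed «difference of exponents»;
* `archChar δ_S = archChar δ₂ · archChar δ₃` (the partition (4) of `MuTable`).

Nothing here says anything about the status of the Hodge conjecture for CM abelian varieties.
-/

set_option autoImplicit false

noncomputable section

namespace Summit.Ventures.HodgeRepro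

open NumberField MuTable

namespace MuTableChars

variable {L : Type} [Field L] [NumberField L] [NumberField.IsCMField L]

/-- A unitary element of `L` is non-zero. -/
theorem unitary_ne_zero (x : unitary L) : (x : L) ≠ 0 := by
  intro h
  have := Unitary.coe_star_mul_self x
  rw [h, mul_zero] at this
  exact zero_ne_one this

/-- Its image under any embedding is non-zero. -/
theorem embedding_unitary_ne_zero (w : InfinitePlace L) (x : unitary L) : w.embedding (x : L) ≠ 0 :=
  (map_ne_zero _).2 (unitary_ne_zero x)

/-- **The archimedean character with exponent table `e`**: `x ↦ ∏_w w(x)^{e(w)}` on `U(1)(L)`. -/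
def archChar (e : InfinitePlace L → ℤ) : unitary L →* ℂ where
  toFun x := ∏ w : InfinitePlace L, (w.embedding (x : L)) ^ (e w)
  map_one' := by simp
  map_mul' x y := by
    rw [← Finset.prod_mul_distrib]
    refine Finset.prod_congr rfl fun w _ => ?_
    rw [Submonoid.coe_mul, map_mul, mul_zpow]

/-- The value of `archChar`. -/
theorem archChar_apply (e : InfinitePlace L → ℤ) (x : unitary L) :
    archChar e x = ∏ w : InfinitePlace L, (w.embedding (x : L)) ^ (e w) := rfl

/-- The zero table gives the trivial character. -/
theorem archChar_zero (x : unitary L) : archChar (0 : InfinitePlace L → ℤ) x = 1 := by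
  simp [archChar_apply]

/-- Exponent tables add, characters multiply. -/
theorem archChar_add (e₁ e₂ : InfinitePlace L → ℤ) (x : unitary L) :
    archChar (e₁ + e₂) x = archChar e₁ x * archChar e₂ x := by
  simp only [archChar_apply, Pi.add_apply]
  rw [← Finset.prod_mul_distrib]
  refine Finset.prod_congr rfl fun w _ => ?_
  exact zpow_add₀ (embedding_unitary_ne_zero w x) _ _

/-- `|w(x)| = 1` for unitary `x`: `w(x) · w(x̄) = w(x x̄) = 1` and `w(x̄) = conj w(x)`. -/
theorem norm_embedding_unitary (w : InfinitePlace L) (x : unitary L) : ‖w.embedding (x : L)‖ = 1 := by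
  have h : w.embedding (x : L) * w.embedding (star (x : L)) = 1 := by
    rw [← map_mul, Unitary.mul_star_self_of_mem x.2, map_one]
  have hstar : w.embedding (star (x : L)) = (starRingEnd ℂ) (w.embedding (x : L)) := by
    show w.embedding (IsCMField.complexConj L (x : L)) = _
    rw [IsCMField.complexEmbedding_complexConj]
  rw [hstar, Complex.mul_conj, ← Complex.ofReal_one, Complex.ofReal_inj, Complex.normSq_eq_norm_sq] at h
  have h0 : 0 ≤ ‖w.embedding (x : L)‖ := norm_nonneg _
  nlinarith [h, h0]

/-- The archimedean characters take values on the unit circle. -/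
theorem norm_archChar (e : InfinitePlace L → ℤ) (x : unitary L) : ‖archChar e x‖ = 1 := by
  rw [archChar_apply, norm_prod]
  refine Finset.prod_eq_one fun w _ => ?_
  rw [norm_zpow, norm_embedding_unitary, one_zpow]

/-- **The character of slot `k`** of the table `μ` at the seesaw datum `S`. -/
def slotChar (μ : Table L) (S : SeesawDatum L) (k : Fin 4) : unitary L →* ℂ := archChar (μ S k)

/-- Slot `0` of the sharpened table carries the character of slot `0`. -/
theorem slotChar_sharp_zero (δ : L) (μ : Table L) (S : SeesawDatum L) :
    slotChar (muSharp₂₃ δ μ) S 0 = slotChar μ S 0 := by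
  unfold slotChar
  rw [muSharp₂₃_zero]

/-- Slot `1` of the sharpened table: the character of slot `0` times the character of the slot table `δ_S` —
«`δ_S` records the difference of the archimedean exponents of the characters attached to lines `1` and `0`». -/
theorem slotChar_sharp_one (δ : L) (μ : Table L) (S : SeesawDatum L) (x : unitary L) :
    slotChar (muSharp₂₃ δ μ) S 1 x = slotChar μ S 0 x * archChar (slotDelta δ S) x := by
  unfold slotChar
  rw [muSharp₂₃_one, archChar_add]

/-- Slot `2`: the character of slot `0` times the character of `δ₂`. -/
theorem slotChar_sharp_two (δ : L) (μ : Table L) (S : SeesawDatum L) (x : unitary L) :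
    slotChar (muSharp₂₃ δ μ) S 2 x = slotChar μ S 0 x * archChar (slotDelta₂ δ S) x := by
  unfold slotChar
  rw [muSharp₂₃_two, archChar_add]

/-- Slot `3`: the character of slot `0` times the character of `δ₃`. -/
theorem slotChar_sharp_three (δ : L) (μ : Table L) (S : SeesawDatum L) (x : unitary L) :
    slotChar (muSharp₂₃ δ μ) S 3 x = slotChar μ S 0 x * archChar (slotDelta₃ δ S) x := by
  unfold slotChar
  rw [muSharp₂₃_three, archChar_add]

/-- The partition `δ₂ + δ₃ = δ_S` of `MuTable` (4) as an identity of characters. -/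
theorem archChar_slotDelta (δ : L) (S : SeesawDatum L) (x : unitary L) :
    archChar (slotDelta δ S) x = archChar (slotDelta₂ δ S) x * archChar (slotDelta₃ δ S) x := by
  have h : slotDelta₂ δ S + slotDelta₃ δ S = slotDelta δ S :=
    funext fun w => (slotDelta₂_add_slotDelta₃ δ S w).1
  rw [← archChar_add, h]

/-- The GAUGE clause (2) of `MuTable` for characters: every sharpened slot character is the slot-`0` character of `μ`
times the corresponding slot character of the sharpened ZERO table. -/
theorem slotChar_sharp_eq (δ : L) (μ : Table L) (S : SeesawDatum L) (k : Fin 4) (x : unitary L) :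
    slotChar (muSharp₂₃ δ μ) S k x = slotChar μ S 0 x * slotChar (muSharp₂₃ δ muSlotZero) S k x := by
  have h0 : slotChar (muSlotZero : Table L) S 0 x = 1 := archChar_zero x
  fin_cases k
  · show slotChar (muSharp₂₃ δ μ) S 0 x = slotChar μ S 0 x * slotChar (muSharp₂₃ δ muSlotZero) S 0 x
    rw [slotChar_sharp_zero, slotChar_sharp_zero, h0, mul_one]
  · show slotChar (muSharp₂₃ δ μ) S 1 x = slotChar μ S 0 x * slotChar (muSharp₂₃ δ muSlotZero) S 1 x
    rw [slotChar_sharp_one, slotChar_sharp_one, h0, one_mul]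
  · show slotChar (muSharp₂₃ δ μ) S 2 x = slotChar μ S 0 x * slotChar (muSharp₂₃ δ muSlotZero) S 2 x
    rw [slotChar_sharp_two, slotChar_sharp_two, h0, one_mul]
  · show slotChar (muSharp₂₃ δ μ) S 3 x = slotChar μ S 0 x * slotChar (muSharp₂₃ δ muSlotZero) S 3 x
    rw [slotChar_sharp_three, slotChar_sharp_three, h0, one_mul]

end MuTableChars

end Summit.Ventures.HodgeRepro

end
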